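import Mathlib
import HarnessLib
import Literature.Computability.AlgebraicComplexity.SymmetricArithCircuit
import Literature.Computability.AlgebraicComplexity.DawarWilsenach2025Proofs
import Literature.Computability.AlgebraicComplexity.MonotoneStructure
import Summits.ValiantsHypothesis.ValiantsHypothesis.Theorems.MonotoneRestorationMonotoneRestorationQPGateSupport
import Summits.ValiantsHypothesis.ValiantsHypothesis.Theorems.MonotoneRestorationMonotoneRestorationQPGammaSpine
import Summits.ValiantsHypothesis.ValiantsHypothesis.Theorems.MonotoneRestorationMonotoneRestorationQPEsymmRowSumsStructure

/-!
# ValiantsHypothesis / MonotoneRestoration — `MonotoneRestorationQP`, line `Sketch`: Theorem γ with an exponential bound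

Support file for crux item `stmt-ValiantsHypothesis-15886`
(`Summit.ValiantsHypothesis.ValiantsHypothesis.Theses.MonotoneRestoration.MonotoneRestorationQP`),
line `Sketch`, Theorem γ (the cancellation-free strengthening of the crux is false; invested
seat xfam-a, direct attempt A on stub G6 `stub_symmetricMonotone_choose_le_card`). The
registered form of G6 (`k² ≤ d`, `d + k + 9 ≤ n`; landed by seat xfam-b, p142541) gives
`2^{Ω(√n log n)}` gates for `e_{n/2}` of the row sums. This file proves the LINEAR-DEGREE form
`symmetricMonotone_choose_le_card_of_three_mul_le`:

> a `Sym_n`-symmetric labelled arithmetic circuit over the semiring `ℝ≥0` (Dawar–Wilsenach,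
> unbounded fan-in, diagonal action on the matrix of variables) whose output is a nonzero
> homogeneous ROW-MULTILINEAR polynomial of degree `d` has at least `C(n, k)` gates whenever
> `8 < n`, `2 ≤ k`, `4k ≤ n`, `3k ≤ d + 2` and `d + k ≤ n`,

which contains G6 (`k² ≥ 3k - 2` for every `k`) and yields the EXPONENTIAL bound
`C(n, ⌊n/6⌋) = 2^{Ω(n)}` for every symmetric monotone circuit computing `e_{⌊n/2⌋}` of the
row sums (`esymmRowSums_half_symmetricMonotone_choose_le_card`, `n ≥ 12`), although that
polynomial has monotone complexity `O(n²)` and polynomial symmetric complexity over `ℂ`.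

Proof (the monotone spine, files `…QPRowShadow`, `…QPGammaSpine`; no bound on the fan-in, no
invariance of individual children, nothing about `Alt` beyond G1 and `3`-cycles). Suppose
`|G| < C(n,k)`. By the support theorem G1 (`stub_gateSupport`) every gate `g` is guarded by a
set `X_g` of `< k` rows: every even permutation fixing `X_g` pointwise extends to an
automorphism fixing `g`. A spine state at `g` is a monomial `m` of `C.eval g` and a context `e`
with `m' + e ∈ supp f` for all monomials `m'` of `C.eval g`. CLAIM (`spine_degree_lt`,
well-founded induction along the wires): every spine state has `deg m < k`. At an input gate
`deg m ≤ 1`; at a `+` gate the state passes unchanged to a child (`coeff_le_coeff_sum`); at a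
`×` gate with `deg m ≥ k` the dichotomy `spine_degree_dichotomy` gives `deg m ≥ d - k + 1`, the
step `mulGate_spine_step` gives a child state of degree `≥ deg m - (k - 1)`, which is `< k` by
induction: `d ≤ 3k - 3`, contradicting `3k ≤ d + 2`. Applied to the output (context `0`,
degree `d ≥ k`) the claim is absurd.
-/

-- `Summit.ValiantsHypothesis.ValiantsHypothesis.…` is the tree's mandated single-conjunct layout
-- (Sub = Summit), so the duplicated namespace component is intended.
set_option linter.dupNamespace false

noncomputable section

namespace Summit.ValiantsHypothesis.ValiantsHypothesis.Theorems

open Literature.Computability.AlgebraicComplexity MvPolynomial Finset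
open scoped NNReal

variable {n : ℕ} {G : Type} [Fintype G]

/-- **The spine claim.** In a `Sym_n`-symmetric circuit over `ℝ≥0` with fewer than `C(n,k)`
gates whose output is homogeneous of degree `d` and row-multilinear (`8 < n`, `2 ≤ k`,
`4k ≤ n`, `3k ≤ d + 2`, `d + k ≤ n`), every spine state `(m, e)` at every gate has `deg m < k`.
[folklore] -/
theorem spine_degree_lt (C : LabelledArithCircuit ℝ≥0 (Fin n × Fin n) Unit G)
    (hC : C.IsSymmetric (Equiv.Perm (Fin n))) {d k : ℕ}
    (hhom : (C.eval (C.output ())).IsHomogeneous d)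
    (hrow : ∀ m ∈ (C.eval (C.output ())).support, ∀ i : Fin n, rowDegrees m i ≤ 1)
    (hn : 8 < n) (hk : 2 ≤ k) (h4k : 4 * k ≤ n) (hkd : 3 * k ≤ d + 2) (hdk : d + k ≤ n)
    (hcard : Fintype.card G < n.choose k) (g : G) {m e : Fin n × Fin n →₀ ℕ}
    (hm : m ∈ (C.eval g).support)
    (he : ∀ m' ∈ (C.eval g).support, m' + e ∈ (C.eval (C.output ())).support) :
    m.degree < k := by
  classical
  -- G1: every gate is guarded by fewer than `k` rows
  have hG1 := fun g => stub_gateSupport C hC hn (by omega : 1 ≤ k) h4k hcard g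
  choose X hXk hX using hG1
  have hX3 : ∀ g, (X g).card + 3 ≤ n := fun g => by
    have := hXk g
    omega
  induction g using C.wf.induction generalizing m e with
  | h g ih =>
    rcases hl : C.label g with x | c | _ | _
    · -- variable gate: `m = single x 1`
      rw [C.eval_of_label_var hl, support_X, mem_singleton] at hm
      rw [hm, Finsupp.degree_single]
      omega
    · -- constant gate: `m = 0`
      rw [C.eval_of_label_const hl, C_apply] at hm
      have h0 := support_monomial_subset hm
      rw [mem_singleton] at h0
      rw [h0, map_zero]
      omega
    · -- addition gate: the state passes to a child
      have hm' := hm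
      rw [C.eval_of_label_add hl] at hm'
      obtain ⟨h, hh, hmh⟩ : ∃ h ∈ C.children g, m ∈ (C.eval h).support := by
        simpa only [mem_biUnion] using support_sum hm'
      refine ih h hh hmh fun m' hm'h => he m' ?_
      rw [C.eval_of_label_add hl, mem_support_iff]
      rw [mem_support_iff] at hm'h
      exact fun h0 => hm'h (le_antisymm
        ((coeff_le_coeff_sum (C.children g) (fun x => C.eval x) hh m').trans h0.le) zero_le)
    · -- multiplication gate
      by_contra hge
      push Not at hge
      have hD : d < m.degree + k :=
        (spine_degree_dichotomy C hhom hrow hk (X g) (hXk g) (hX3 g) (hX g) hm he).resolve_left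
          (not_lt.2 hge)
      obtain ⟨h, hh, m', e', hm', he', hdeg⟩ :=
        mulGate_spine_step C hhom hrow hl (X g) (hXk g) (hX3 g) hdk (hX g) hm he hge
      have h1 := ih h hh hm' he'
      have h2 := hXk g
      omega

/-- **Theorem γ, linear-degree form.** A `Sym_n`-symmetric labelled arithmetic circuit over the
semiring `ℝ≥0` whose output is a nonzero homogeneous row-multilinear polynomial of degree `d` has
at least `C(n, k)` gates whenever `8 < n`, `2 ≤ k`, `4k ≤ n`, `3k ≤ d + 2`, `d + k ≤ n`
(spine claim at the output gate with empty context). The registered stub G6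
`stub_symmetricMonotone_choose_le_card` (`k² ≤ d`, `d + k + 9 ≤ n`) is the special case
`k² ≥ 3k - 2`. [folklore] -/
theorem symmetricMonotone_choose_le_card_of_three_mul_le {n : ℕ} {G : Type} [Fintype G]
    (C : LabelledArithCircuit NNReal (Fin n × Fin n) Unit G)
    (hC : C.IsSymmetric (Equiv.Perm (Fin n))) {d k : ℕ}
    (hhom : (C.eval (C.output ())).IsHomogeneous d) (h0 : C.eval (C.output ()) ≠ 0)
    (hrow : ∀ m ∈ (C.eval (C.output ())).support, ∀ i : Fin n, rowDegrees m i ≤ 1)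
    (hn : 8 < n) (hk : 2 ≤ k) (h4k : 4 * k ≤ n) (hkd : 3 * k ≤ d + 2) (hdk : d + k ≤ n) :
    n.choose k ≤ Fintype.card G := by
  by_contra hlt
  push Not at hlt
  obtain ⟨m, hm⟩ := support_nonempty.2 h0
  have he : ∀ m' ∈ (C.eval (C.output ())).support,
      m' + 0 ∈ (C.eval (C.output ())).support := fun m' hm' => by rwa [add_zero]
  have hdeg := spine_degree_add_eq C hhom he hm
  rw [map_zero, add_zero] at hdeg
  have := spine_degree_lt C hC hhom hrow hn hk h4k hkd hdk hlt (C.output ()) hm he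
  omega

/-- **Theorem γ for `e_d` of the row sums.** Every `Sym_n`-symmetric circuit over `ℝ≥0`
computing `e_d(R_1, …, R_n)`, `R_i = Σ_j x_{ij}` (homogeneous of degree `d`, row-multilinear,
nonzero for `d ≤ n`: `esymmRowSumsStructure_*`), has at least `C(n, k)` gates whenever `8 < n`,
`2 ≤ k`, `4k ≤ n`, `3k ≤ d + 2`, `d + k ≤ n`. [folklore] -/
theorem esymmRowSums_symmetricMonotone_choose_le_card {n : ℕ} {G : Type} [Fintype G]
    (C : LabelledArithCircuit NNReal (Fin n × Fin n) Unit G)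
    (hC : C.IsSymmetric (Equiv.Perm (Fin n))) {d k : ℕ}
    (hCe : C.eval (C.output ()) =
      bind₁ (fun i : Fin n => ∑ j : Fin n, (X (i, j) : MvPolynomial (Fin n × Fin n) ℝ≥0))
        (esymm (Fin n) ℝ≥0 d))
    (hn : 8 < n) (hk : 2 ≤ k) (h4k : 4 * k ≤ n) (hkd : 3 * k ≤ d + 2) (hdk : d + k ≤ n) :
    n.choose k ≤ Fintype.card G := by
  refine symmetricMonotone_choose_le_card_of_three_mul_le C hC (d := d) ?_ ?_ ?_ hn hk h4k hkd hdk
  · rw [hCe]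
    exact esymmRowSumsStructure_isHomogeneous n d
  · rw [hCe]
    exact esymmRowSumsStructure_ne_zero n d (by omega)
  · rw [hCe]
    exact esymmRowSumsStructure_rowDegrees_le n d

/-- **Exponential lower bound for symmetric monotone circuits.** For `n ≥ 12`, every
`Sym_n`-symmetric circuit over `ℝ≥0` computing `e_{⌊n/2⌋}` of the row sums — a polynomial of
monotone complexity `O(n²)` — has at least `C(n, ⌊n/6⌋) = 2^{Ω(n)}` gates
(`k = ⌊n/6⌋`, `d = ⌊n/2⌋` in `esymmRowSums_symmetricMonotone_choose_le_card`). [folklore] -/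
theorem esymmRowSums_half_symmetricMonotone_choose_le_card {n : ℕ} {G : Type} [Fintype G]
    (C : LabelledArithCircuit NNReal (Fin n × Fin n) Unit G)
    (hC : C.IsSymmetric (Equiv.Perm (Fin n)))
    (hCe : C.eval (C.output ()) =
      bind₁ (fun i : Fin n => ∑ j : Fin n, (X (i, j) : MvPolynomial (Fin n × Fin n) ℝ≥0))
        (esymm (Fin n) ℝ≥0 (n / 2)))
    (hn : 12 ≤ n) : n.choose (n / 6) ≤ Fintype.card G :=
  esymmRowSums_symmetricMonotone_choose_le_card C hC hCe (by omega) (by omega) (by omega)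
    (by omega) (by omega)

end Summit.ValiantsHypothesis.ValiantsHypothesis.Theorems

end
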